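import Summits.ResolutionOfSingularities.ResolutionOfSingularities.Theorems.PurelyInseparableDim4ResConeSatChain
import HarnessLib
import HarnessLib.Audit.Tags

/-!
# Purely inseparable four-folds — the TAME CONE AT A CONSTANT-`d` STEP, IX: RUN PERSISTENCE and the
# RETURN-OR-SHED law for the chart letters of a constant-`(d, e_G ≤ 2)` tail (idea-4 g3 memo E2-WINDOW (A1))

[OURS · counted 0 · cell `res-dim4-pi` · desk WORD #66 (2) (K2(p) lower-band lane, owner p-12 g2) · seat
res-dim4-p-5 g2 · K lane crit-4 g2 (K-A4).]  Nothing here proves K2(p), `NoIsolatedTrap p p` or resolution of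
singularities in dimension ≥ 4 / characteristic `p`.

Setting (`…ResConeSatChain`): an isolated above-floor `Step0 p` chain `c` with `x^{r₀} ∣ F₀`, witnessed by
`(j k, b k)` (`FreeTail.IsWitnessedChain`), with constant shade and CONSTANT polar-kernel dimension
`finrank (resVertex (c k)) = e` for `k ≥ k₀`.  A CHANGE at time `k` is `j (k+1) ≠ j k`; it is a satellite change when
moreover `b (k+1) (j k) = 0` (the component created at step `k` is kept).  A RUN is a maximal interval of equal chart
letters.

* **`chain_resVertex_step_inf_hyperplane_eq`** — (I2) along the chain: `V_{k+1} ∩ H_{j k} = V_k ∩ H_{j k}`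
  (`…SatLocated.resVertex_step_inf_hyperplane_eq_of_finrank_eq` with the chain's band data);
* **`chain_resVertex_inf_hyperplane_run`** (RUN PERSISTENCE) — on a run `j τ = j₁` (`k₁ < τ ≤ k₂`) the line
  `V_τ ∩ H_{j₁}` is the same for all `k₁ + 1 ≤ τ ≤ k₂ + 1`;
* **`chain_return_or_shed`** (E2-WINDOW (A1)(ii), honest general form, `e ≤ 2`) — for CONSECUTIVE satellite changes
  at `k₁ < k₂`: `j (k₂+1) = j k₁ ∨ b (k₂+1) (j k₁) ≠ 0` — the next change RETURNS to the previous chart letter or SHEDS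
  that component by a translation.  (`k₂ = k₁ + 1` is NO-YOUNG-CORNER.)  Proof: the direction `w₂` of step `k₂+1`
  lies in `V_{k₂+1} ∩ H_{j₁} = V_{k₁+1} ∩ H_{j₁}` (run persistence); if it also lies in `H_{j k₁}` it belongs to the
  rank-`≤ 1` space `V_{k₁+1} ∩ H_{j k₁}` spanned by the direction `w₁` of step `k₁+1`, and the `j₁`-coordinate of
  `w₂ = a • w₁` reads `0 = a`;
* **`chain_return_of_kept`** — idea-4's corner form: if the change at `k₂` keeps the component `j k₁`, the chart
  returns to it: the chart letters of a one-loss-per-step `e_G ≡ 2` tail read `a⁺ b⁺ a⁺ b⁺ …` inside a FIXED pair.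

[cite: CossartJannsenSaito2020, Thm. 3.10(4), Thm. 3.14, Thm. 9.3]
bears_on: LADDER-RESOLUTION:D157-DOOR2 (res-dim4-pi · K2(p) = `RidgeBudget.NoAboveFloorTrap p p`, lower band).
Supports stmt-ResolutionOfSingularities-16155 (helper).
-/

set_option linter.dupNamespace false -- mandated namespace of this single-conjunct summit

noncomputable section

namespace Summit.ResolutionOfSingularities.ResolutionOfSingularities.Theorems.PIDim4

namespace ResCone

open MvPolynomial Finset
open Literature.AlgebraicGeometry.Resolution
open Literature.AlgebraicGeometry.Resolution.CentreBlowup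
open Literature.AlgebraicGeometry.Resolution.Hauser2010
open Literature.AlgebraicGeometry.Resolution.HauserPerlega2019
open PointBlowup (polarMap additiveSubspace direction)

variable {K : Type} [Field K]

section Alternation

variable (p : ℕ) [Fact p.Prime] [DecidableEq K]

/-- **(I2) along the chain**: on the constant-`(d, e_G)` tail, `resVertex (c (k+1)) ⊓ H_{j k} = resVertex (c k) ⊓ H_{j k}`.
[OURS] [cite: CossartJannsenSaito2020, Thm. 3.10(4), Thm. 9.3] -/
theorem chain_resVertex_step_inf_hyperplane_eq {c : ℕ → State K} {j : ℕ → Fin 4} {b : ℕ → Fin 4 → K}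
    (hc : ∀ k, IsIsolated p (c k).F ∧ Step0 p (c k) (c (k + 1))) (hw : FreeTail.IsWitnessedChain p c j b)
    (hr0 : ∀ e ∈ (c 0).F.support, (c 0).r ≤ e) (hfloor : ∀ k, ordZero (c k).F ≠ p) {k₀ : ℕ} {d : ℕ∞}
    (hshade : ∀ k, k₀ ≤ k → (c k).shade = d) {e : ℕ}
    (he : ∀ k, k₀ ≤ k → Module.finrank K (resVertex (c k)) = e) {k : ℕ} (hk : k₀ ≤ k) :
    resVertex (c (k + 1)) ⊓ hyperplane (j k) = resVertex (c k) ⊓ hyperplane (j k) := by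
  obtain ⟨o, ho, hpo, ho2⟩ := chain_band p hc hfloor k
  have hck := (hw k).2.2.2.2
  have hfin : Module.finrank K (resVertex (CentreBlowup.step p Finset.univ (j k) (b k) (c k))) =
      Module.finrank K (resVertex (c k)) := by
    rw [← hck, he (k + 1) (by omega), he k hk]
  rw [hck]
  exact resVertex_step_inf_hyperplane_eq_of_finrank_eq (j k) (hw k).2.1 ho
    (IsolatedBand.isolated_chain_forall_le hc hr0 k) hpo ho2 (chain_shade_step p hw hshade hk) hfin

/-- **RUN PERSISTENCE**: on a run of equal chart letters `j τ = j (k₁+1)` for `k₁ < τ ≤ k₂` (inside the constant tail),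
the line `resVertex (c τ) ⊓ H_{j (k₁+1)}` does not depend on `τ ∈ [k₁+1, k₂+1]`. [OURS]
[cite: CossartJannsenSaito2020, Thm. 3.10(4), Thm. 9.3] -/
theorem chain_resVertex_inf_hyperplane_run {c : ℕ → State K} {j : ℕ → Fin 4} {b : ℕ → Fin 4 → K}
    (hc : ∀ k, IsIsolated p (c k).F ∧ Step0 p (c k) (c (k + 1))) (hw : FreeTail.IsWitnessedChain p c j b)
    (hr0 : ∀ e ∈ (c 0).F.support, (c 0).r ≤ e) (hfloor : ∀ k, ordZero (c k).F ≠ p) {k₀ : ℕ} {d : ℕ∞}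
    (hshade : ∀ k, k₀ ≤ k → (c k).shade = d) {e : ℕ}
    (he : ∀ k, k₀ ≤ k → Module.finrank K (resVertex (c k)) = e) {k₁ k₂ : ℕ} (hk : k₀ ≤ k₁) (hk₁₂ : k₁ ≤ k₂)
    (hrun : ∀ τ, k₁ < τ → τ ≤ k₂ → j τ = j (k₁ + 1)) :
    ∀ n, k₁ + 1 + n ≤ k₂ + 1 →
      resVertex (c (k₁ + 1 + n)) ⊓ hyperplane (j (k₁ + 1)) = resVertex (c (k₁ + 1)) ⊓ hyperplane (j (k₁ + 1))
  | 0, _ => rfl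
  | n + 1, hn => by
    have ih := chain_resVertex_inf_hyperplane_run hc hw hr0 hfloor hshade he hk hk₁₂ hrun n (by omega)
    have hτ : j (k₁ + 1 + n) = j (k₁ + 1) := hrun (k₁ + 1 + n) (by omega) (by omega)
    have hstep := chain_resVertex_step_inf_hyperplane_eq p hc hw hr0 hfloor hshade he
      (show k₀ ≤ k₁ + 1 + n by omega)
    rw [hτ] at hstep
    rw [show k₁ + 1 + (n + 1) = k₁ + 1 + n + 1 by ring, hstep, ih]

/-- **RETURN-OR-SHED (idea-4 g3 E2-WINDOW (A1)(ii), general tails, `e_G ≤ 2`)**: let `k₁ < k₂` be CONSECUTIVE change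
times of the constant tail (`j (k₁+1) ≠ j k₁`, `j` constant on `(k₁, k₂]`, `j (k₂+1) ≠ j k₂`), both SATELLITE changes
(`b (k₁+1) (j k₁) = 0`, `b (k₂+1) (j k₂) = 0`).  Then `j (k₂+1) = j k₁ ∨ b (k₂+1) (j k₁) ≠ 0`: the chart RETURNS to the
previous letter, or the component `j k₁` is SHED by a translation. [OURS]
[cite: CossartJannsenSaito2020, Thm. 3.10(4), Thm. 3.14, Thm. 9.3] -/
theorem chain_return_or_shed {c : ℕ → State K} {j : ℕ → Fin 4} {b : ℕ → Fin 4 → K}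
    (hc : ∀ k, IsIsolated p (c k).F ∧ Step0 p (c k) (c (k + 1))) (hw : FreeTail.IsWitnessedChain p c j b)
    (hr0 : ∀ e ∈ (c 0).F.support, (c 0).r ≤ e) (hfloor : ∀ k, ordZero (c k).F ≠ p) {k₀ : ℕ} {d : ℕ∞}
    (hshade : ∀ k, k₀ ≤ k → (c k).shade = d) {e : ℕ}
    (he : ∀ k, k₀ ≤ k → Module.finrank K (resVertex (c k)) = e) (he2 : e ≤ 2) {k₁ k₂ : ℕ} (hk : k₀ ≤ k₁)
    (hk₁₂ : k₁ < k₂) (hsat₁ : FreeTail.IsSatellite j b k₁) (hrun : ∀ τ, k₁ < τ → τ ≤ k₂ → j τ = j (k₁ + 1))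
    (hsat₂ : FreeTail.IsSatellite j b k₂) : j (k₂ + 1) = j k₁ ∨ b (k₂ + 1) (j k₁) ≠ 0 := by
  by_contra hno
  push Not at hno
  obtain ⟨hne, hshed⟩ := hno
  have hj₂ : j k₂ = j (k₁ + 1) := hrun k₂ hk₁₂ le_rfl
  -- `w₁ ∈ V_{k₁+1} ∩ H_{j k₁}` spans a line of rank `≤ 1`
  have hw₁ : direction (j (k₁ + 1)) (b (k₁ + 1)) ∈ resVertex (c (k₁ + 1)) ⊓ hyperplane (j k₁) := by
    refine Submodule.mem_inf.mpr ⟨chain_direction_mem_resVertex p hc hw hr0 hfloor hshade (by omega),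
      mem_hyperplane.mpr ?_⟩
    rw [direction_apply_of_ne (Ne.symm hsat₁.1)]
    exact hsat₁.2
  have hrank : Module.finrank K ↥(resVertex (c (k₁ + 1)) ⊓ hyperplane (j k₁)) ≤ 1 := by
    obtain ⟨o, ho, hpo, ho2⟩ := chain_band p hc hfloor k₁
    have h := finrank_resVertex_step_inf_hyperplane_add_one_le (j k₁) (hw k₁).2.1 ho
      (IsolatedBand.isolated_chain_forall_le hc hr0 k₁) hpo ho2 (chain_shade_step p hw hshade hk)
    rw [← (hw k₁).2.2.2.2, he k₁ hk] at h
    omega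
  -- `w₂ ∈ V_{k₂+1} ∩ H_{j (k₁+1)} = V_{k₁+1} ∩ H_{j (k₁+1)}` (run persistence), and `w₂ ∈ H_{j k₁}` (not shed)
  have hw₂V : direction (j (k₂ + 1)) (b (k₂ + 1)) ∈ resVertex (c (k₂ + 1)) ⊓ hyperplane (j (k₁ + 1)) := by
    refine Submodule.mem_inf.mpr ⟨chain_direction_mem_resVertex p hc hw hr0 hfloor hshade (by omega),
      mem_hyperplane.mpr ?_⟩
    have h2 := hsat₂.2
    rw [hj₂] at h2
    rw [direction_apply_of_ne (by rw [← hj₂]; exact Ne.symm hsat₂.1)]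
    exact h2
  have hpers := chain_resVertex_inf_hyperplane_run p hc hw hr0 hfloor hshade he hk hk₁₂.le hrun (k₂ - k₁)
    (by omega)
  rw [show k₁ + 1 + (k₂ - k₁) = k₂ + 1 by omega] at hpers
  rw [hpers] at hw₂V
  have hw₂ : direction (j (k₂ + 1)) (b (k₂ + 1)) ∈ resVertex (c (k₁ + 1)) ⊓ hyperplane (j k₁) := by
    refine Submodule.mem_inf.mpr ⟨(Submodule.mem_inf.mp hw₂V).1, mem_hyperplane.mpr ?_⟩
    rw [direction_apply_of_ne (Ne.symm hne)]
    exact hshed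
  -- rank one: `w₂ = a • w₁`; the `j (k₁+1)`-coordinate gives `a = 0`
  have hnz : (⟨direction (j (k₁ + 1)) (b (k₁ + 1)), hw₁⟩ :
      ↥(resVertex (c (k₁ + 1)) ⊓ hyperplane (j k₁))) ≠ 0 :=
    fun h => Directrix.direction_ne_zero _ _ (congrArg Subtype.val h)
  have hrank1 : Module.finrank K ↥(resVertex (c (k₁ + 1)) ⊓ hyperplane (j k₁)) = 1 := by
    by_contra hne1
    have h0 : resVertex (c (k₁ + 1)) ⊓ hyperplane (j k₁) = ⊥ := Submodule.finrank_eq_zero.mp (by omega)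
    have hw₁' := hw₁
    rw [h0, Submodule.mem_bot] at hw₁'
    exact Directrix.direction_ne_zero _ _ hw₁'
  obtain ⟨a, ha⟩ := (finrank_eq_one_iff_of_nonzero' _ hnz).mp hrank1 ⟨_, hw₂⟩
  have ha' : a • direction (j (k₁ + 1)) (b (k₁ + 1)) = direction (j (k₂ + 1)) (b (k₂ + 1)) :=
    congrArg Subtype.val ha
  have hcoord := congr_fun ha' (j (k₁ + 1))
  rw [Pi.smul_apply, direction_apply_self, smul_eq_mul, mul_one,
    (mem_hyperplane.mp (Submodule.mem_inf.mp hw₂V).2)] at hcoord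
  -- `a = 0`, so `w₂ = 0`
  rw [hcoord, zero_smul] at ha'
  exact Directrix.direction_ne_zero _ _ ha'.symm

/-- **TWO SUCCESSIVE CHANGES RETURN** (idea-4's corner form of (A1)(ii)): if, in the situation of
`chain_return_or_shed`, the change at `k₂` KEEPS the component `j k₁` (`b (k₂+1) (j k₁) = 0`), then `j (k₂+1) = j k₁`
— the chart letters of such a tail alternate inside a fixed pair. [OURS] [cite: CossartJannsenSaito2020, Thm. 3.14] -/
theorem chain_return_of_kept {c : ℕ → State K} {j : ℕ → Fin 4} {b : ℕ → Fin 4 → K}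
    (hc : ∀ k, IsIsolated p (c k).F ∧ Step0 p (c k) (c (k + 1))) (hw : FreeTail.IsWitnessedChain p c j b)
    (hr0 : ∀ e ∈ (c 0).F.support, (c 0).r ≤ e) (hfloor : ∀ k, ordZero (c k).F ≠ p) {k₀ : ℕ} {d : ℕ∞}
    (hshade : ∀ k, k₀ ≤ k → (c k).shade = d) {e : ℕ}
    (he : ∀ k, k₀ ≤ k → Module.finrank K (resVertex (c k)) = e) (he2 : e ≤ 2) {k₁ k₂ : ℕ} (hk : k₀ ≤ k₁)
    (hk₁₂ : k₁ < k₂) (hsat₁ : FreeTail.IsSatellite j b k₁) (hrun : ∀ τ, k₁ < τ → τ ≤ k₂ → j τ = j (k₁ + 1))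
    (hsat₂ : FreeTail.IsSatellite j b k₂) (hkept : b (k₂ + 1) (j k₁) = 0) : j (k₂ + 1) = j k₁ :=
  (chain_return_or_shed p hc hw hr0 hfloor hshade he he2 hk hk₁₂ hsat₁ hrun hsat₂).resolve_right
    (not_not.mpr hkept)

end Alternation

end ResCone

end Summit.ResolutionOfSingularities.ResolutionOfSingularities.Theorems.PIDim4

end
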